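import Mathlib
import Summits.ValiantsHypothesis.ValiantsHypothesis.Theorems.BarrierLeverTransversalResultantKernelNonsingularTropical
import Summits.ValiantsHypothesis.ValiantsHypothesis.Theorems.BarrierLeverPartitionMinorsHitByVPProductStates

/-!
# Route BarrierLever — item `TropicalDetCertificateSuffices` (stmt-ValiantsHypothesis-19315):
# the TT-level tropical certificate — a unique OUTER optimum over tropical determinants forces a
# nonzero transversal layout minor

**Item (planner p1-g9, the TT analogue of `…ResultantKernel.det_resultantMatrix_ne_zero_of_unique_assignment`).**
For a layout `(u, w)` (`u_i, w_j ⊆ Fin h`), row transversals `ρ_i a = castAdd h a` if `a ∈ u_i`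
else `natAdd h a`, column transversals `τ_j c = natAdd h c` if `c ∈ w_j` else `castAdd h c`, and
ANY weight matrix `D` on `Fin (h+h) × Fin (h+h)`, let `ω i j` be the TROPICAL DETERMINANT
`min_σ Σ_a D (ρ_i a) (τ_j (σ a))` of `D[ρ_i, τ_j]`. If the OUTER assignment problem
`σ ↦ Σ_j ω (σ j) j` has a unique minimiser `π₀`, then some `H : Matrix (Fin (h+h)) (Fin (h+h)) ℂ`
makes the transversal layout matrix `(det H[ρ_i, τ_j])_{i,j}` nonsingular
(`tropicalDetCertificateSuffices`, the signature of item 19315 VERBATIM).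

**Proof.** Put `H_{xy} := c_{xy} · ε^{K − D_{xy}}` with INDETERMINATE `c` (`K ≥ max D`), i.e. work
in `R[ε]`, `R = MvPolynomial (Fin (h+h) × Fin (h+h)) ℂ` (a domain of characteristic zero).
(1) INNER: by Leibniz (`det = det ∘ transpose`), `det H[ρ, τ] = Σ_σ sign σ · (∏_a c_{ρ a, τ (σ a)}) ·
ε^{hK − Σ_a D(ρ a, τ (σ a))}`, so its `ε`-degree is `≤ hK − ω` and the coefficient of `ε^{hK−ω}` is
`L = Σ_{σ optimal} sign σ ∏_a c_{ρ a, τ(σ a)}` — a signed sum of DISTINCT squarefree monomials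
(`σ` is recovered from its monomial because `ρ`, `τ` are injective), hence `L ≠ 0` in `R`
(`inner_leadingCoeff_ne_zero`); so `det H[ρ,τ] ≠ 0` has degree exactly `hK − ω`.
(2) OUTER: in the Leibniz expansion of `det (det H[ρ_i, τ_j])_{ij}` over `R[ε]` the permutation `π₀`
is the unique one of maximal total degree `Σ_j (hK − ω (π₀ j) j)`, so the determinant is nonzero
(`det_ne_zero_of_unique_maxDegree`, any domain of characteristic `0`).
(3) SPECIALISE: a nonzero element of `R[ε]` has a nonzero leading coefficient in `R`, which is
nonzero at some `c ∈ ℂ^{(2h)²}` (`MvPolynomial.funext`); the resulting nonzero complex polynomial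
in `ε` has a non-root; ring maps commute with determinants and submatrices.
No injectivity of `u`, `w` and no uniqueness of the inner optima is needed.

WHAT THIS IS NOT: the certificate must be supplied (conjecture UT-D = item 19316 says one always
exists); nothing on TT/TNS/19717 themselves, on crux stmt-14610, or on `VP` vs `VNP`.

References: [Burgisser2000] §4 (valuative degenerations); Mulmuley–Vazirani–Vazirani 1987 /
Klivans–Spielman 2001 (isolation of one Leibniz term); [ForbesShpilkaVolk2018] Question 6 (context).
-/

-- layout Summits/ValiantsHypothesis/ValiantsHypothesis forces the duplicated namespace component
set_option linter.dupNamespace false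

namespace Summit.ValiantsHypothesis.ValiantsHypothesis.Theorems.BarrierLever.TropicalDet

open Finset Polynomial

noncomputable section

/-! ## 1. Unique permutation of maximal degree ⇒ nonzero determinant (any domain, char 0) -/

/-- **Unique permutation of maximal degree ⇒ nonzero determinant**, over any domain of
characteristic zero: if `σ₀` meets only nonzero entries of `M ∈ R[X]^{r×r}` and every other
permutation meets a zero entry or has a strictly smaller sum of entry degrees, then `det M ≠ 0`. -/
theorem det_ne_zero_of_unique_maxDegree {R : Type*} [CommRing R] [IsDomain R] [CharZero R]
    {r : ℕ} (M : Matrix (Fin r) (Fin r) R[X])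
    (σ₀ : Equiv.Perm (Fin r)) (h0 : ∀ j, M (σ₀ j) j ≠ 0)
    (huniq : ∀ σ : Equiv.Perm (Fin r), σ ≠ σ₀ →
      (∃ j, M (σ j) j = 0) ∨ ∑ j, (M (σ j) j).natDegree < ∑ j, (M (σ₀ j) j).natDegree) :
    M.det ≠ 0 := by
  set N : ℕ := ∑ j, (M (σ₀ j) j).natDegree with hN
  have hfac : ∀ j ∈ (univ : Finset (Fin r)), M (σ₀ j) j ≠ 0 := fun j _ => h0 j
  have hP0 : (∏ j, M (σ₀ j) j).coeff N ≠ 0 := by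
    have hdeg : (∏ j, M (σ₀ j) j).natDegree = N := natDegree_prod _ _ hfac
    rw [← hdeg, coeff_natDegree, leadingCoeff_ne_zero]
    exact Finset.prod_ne_zero_iff.mpr hfac
  have hPσ : ∀ σ : Equiv.Perm (Fin r), σ ≠ σ₀ → (∏ j, M (σ j) j).coeff N = 0 := by
    intro σ hσ
    rcases huniq σ hσ with ⟨j, hj⟩ | hlt
    · rw [Finset.prod_eq_zero (f := fun j => M (σ j) j) (mem_univ j) hj, coeff_zero]
    · exact coeff_eq_zero_of_natDegree_lt ((natDegree_prod_le _ _).trans_lt hlt)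
  have hterm : ∀ σ : Equiv.Perm (Fin r),
      ((((Equiv.Perm.sign σ : ℤˣ) : ℤ) : R[X]) * ∏ j, M (σ j) j).coeff N =
        (((Equiv.Perm.sign σ : ℤˣ) : ℤ) : R) * (∏ j, M (σ j) j).coeff N := by
    intro σ
    rw [← C_eq_intCast, coeff_C_mul]
  intro hdet
  have hcoeff : (M.det).coeff N = 0 := by rw [hdet, coeff_zero]
  rw [Matrix.det_apply', finsetSum_coeff, Finset.sum_eq_single σ₀, hterm] at hcoeff
  · exact mul_ne_zero (Int.cast_ne_zero.mpr (Units.ne_zero _)) hP0 hcoeff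
  · intro σ _ hσ
    rw [hterm, hPσ σ hσ, mul_zero]
  · intro h; exact absurd (mem_univ σ₀) h

/-! ## 2. The inner determinants `det H[ρ, τ]` along `H_{xy} = c_{xy} ε^{K − D_{xy}}` -/

section Inner

variable {h : ℕ}

/-- Leibniz form of the inner determinant in the (row `a`, column `σ a`) orientation:
`det [c_{ρ a, τ c} X^{K − D(ρ a, τ c)}]_{a,c} = Σ_σ sign σ · C (∏_a c_{ρ a, τ (σ a)}) · X^{Σ_a (K − D (ρ a, τ (σ a)))}`. -/
theorem inner_det_eq (ρ τ : Fin h → Fin (h + h)) (D : Fin (h + h) → Fin (h + h) → ℕ) (K : ℕ) :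
    (Matrix.of fun a c : Fin h =>
      (C (MvPolynomial.X (ρ a, τ c)) * X ^ (K - D (ρ a) (τ c)) : (MvPolynomial (Fin (h + h) × Fin (h + h)) ℂ)[X])).det =
      ∑ σ : Equiv.Perm (Fin h), (((Equiv.Perm.sign σ : ℤˣ) : ℤ) : (MvPolynomial (Fin (h + h) × Fin (h + h)) ℂ)[X]) *
        (C (∏ a, MvPolynomial.X (ρ a, τ (σ a))) * X ^ ∑ a, (K - D (ρ a) (τ (σ a)))) := by
  rw [← Matrix.det_transpose, Matrix.det_apply']
  refine Finset.sum_congr rfl fun σ _ => ?_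
  congr 1
  simp only [Matrix.transpose_apply, Matrix.of_apply]
  rw [Finset.prod_mul_distrib, Finset.prod_pow_eq_pow_sum, ← map_prod C]

/-- The `ε`-exponent of a permutation is `hK` minus its `D`-weight when `K` bounds `D`. -/
theorem sum_tsub_eq (ρ τ : Fin h → Fin (h + h)) (D : Fin (h + h) → Fin (h + h) → ℕ) (K : ℕ)
    (hK : ∀ x y, D x y ≤ K) (σ : Equiv.Perm (Fin h)) :
    ∑ a, (K - D (ρ a) (τ (σ a))) = h * K - ∑ a, D (ρ a) (τ (σ a)) := by
  rw [Finset.sum_tsub_distrib univ (fun a _ => hK (ρ a) (τ (σ a)))]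
  simp

/-- The `c`-monomial of a permutation, `∏_a c_{ρ a, τ (σ a)}`, as a `Finsupp` exponent. -/
theorem prod_X_eq_monomial (ρ τ : Fin h → Fin (h + h)) (σ : Equiv.Perm (Fin h)) :
    (∏ a, MvPolynomial.X (ρ a, τ (σ a)) : MvPolynomial (Fin (h + h) × Fin (h + h)) ℂ) =
      MvPolynomial.monomial (∑ a, Finsupp.single (ρ a, τ (σ a)) 1) 1 := by
  rw [MvPolynomial.monomial_sum_one]
  rfl

/-- Values of the exponent `Σ_a single (ρ a, τ (σ a)) 1` at the points `(ρ a₀, τ (σ' a₀))`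
(`ρ`, `τ` injective): `1` if `σ a₀ = σ' a₀`, else `0`. -/
theorem expo_apply (ρ τ : Fin h → Fin (h + h)) (hρ : Function.Injective ρ) (hτ : Function.Injective τ)
    (σ σ' : Equiv.Perm (Fin h)) (a₀ : Fin h) :
    (∑ a, Finsupp.single (ρ a, τ (σ a)) 1 : Fin (h + h) × Fin (h + h) →₀ ℕ) (ρ a₀, τ (σ' a₀)) =
      if σ a₀ = σ' a₀ then 1 else 0 := by
  rw [Finsupp.finsetSum_apply]
  have key : ∀ a, (Finsupp.single (ρ a, τ (σ a)) 1 : Fin (h + h) × Fin (h + h) →₀ ℕ)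
      (ρ a₀, τ (σ' a₀)) = if a = a₀ then (if σ a₀ = σ' a₀ then 1 else 0) else 0 := by
    intro a
    rw [Finsupp.single_apply]
    by_cases ha : a = a₀
    · subst ha
      by_cases hs : σ a = σ' a
      · simp [hs]
      · rw [if_neg, if_pos rfl, if_neg hs]
        intro heq
        exact hs (hτ (Prod.mk.inj heq).2)
    · rw [if_neg, if_neg ha]
      intro heq
      exact ha (hρ (Prod.mk.inj heq).1)
  simp_rw [key]
  rw [Finset.sum_ite_eq' univ a₀]
  simp

/-- Injectivity: the `c`-monomial determines the permutation. -/
theorem expo_injective (ρ τ : Fin h → Fin (h + h)) (hρ : Function.Injective ρ)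
    (hτ : Function.Injective τ) (σ σ' : Equiv.Perm (Fin h))
    (heq : (∑ a, Finsupp.single (ρ a, τ (σ a)) 1 : Fin (h + h) × Fin (h + h) →₀ ℕ) =
      ∑ a, Finsupp.single (ρ a, τ (σ' a)) 1) : σ = σ' := by
  ext a₀
  have h1 := expo_apply ρ τ hρ hτ σ' σ' a₀
  rw [if_pos rfl, ← heq, expo_apply ρ τ hρ hτ σ σ' a₀] at h1
  by_contra hne
  rw [if_neg (fun e => hne (congrArg Fin.val e))] at h1
  exact zero_ne_one h1

/-- Integer scalars in `R` are constants: `(z : R) = C z`. -/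
theorem intCast_eq_C (z : ℤ) : ((z : MvPolynomial (Fin (h + h) × Fin (h + h)) ℂ)) = MvPolynomial.C ((z : ℂ)) :=
  (map_intCast (MvPolynomial.C : ℂ →+* MvPolynomial (Fin (h + h) × Fin (h + h)) ℂ) z).symm

/-- **The inner leading coefficient is nonzero.** For any nonempty set `S` of permutations, the
signed sum `Σ_{σ ∈ S} sign σ ∏_a c_{ρ a, τ (σ a)}` of distinct squarefree monomials is `≠ 0`. -/
theorem signedSum_prod_X_ne_zero (ρ τ : Fin h → Fin (h + h)) (hρ : Function.Injective ρ)
    (hτ : Function.Injective τ) (S : Finset (Equiv.Perm (Fin h))) (hS : S.Nonempty) :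
    (∑ σ ∈ S, (((Equiv.Perm.sign σ : ℤˣ) : ℤ) : MvPolynomial (Fin (h + h) × Fin (h + h)) ℂ) * ∏ a, MvPolynomial.X (ρ a, τ (σ a))) ≠ 0 := by
  obtain ⟨σ₀, hσ₀⟩ := hS
  intro hzero
  have hc := congrArg (MvPolynomial.coeff (∑ a, Finsupp.single (ρ a, τ (σ₀ a)) 1)) hzero
  rw [MvPolynomial.coeff_sum, MvPolynomial.coeff_zero, Finset.sum_eq_single σ₀] at hc
  · rw [prod_X_eq_monomial, intCast_eq_C, MvPolynomial.coeff_C_mul,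
      MvPolynomial.coeff_monomial, if_pos rfl, mul_one] at hc
    exact (Int.cast_ne_zero.mpr (Units.ne_zero _)) hc
  · intro σ _ hσ
    rw [prod_X_eq_monomial, intCast_eq_C, MvPolynomial.coeff_C_mul,
      MvPolynomial.coeff_monomial, if_neg, mul_zero]
    exact fun heq => hσ (expo_injective ρ τ hρ hτ σ σ₀ heq)
  · intro hn; exact absurd hσ₀ hn

/-- **The inner determinant: degree and leading coefficient.** With `ω = min_σ Σ_a D(ρ a, τ(σ a))`
and `K ≥ max D`, `det [c_{ρ a, τ c} ε^{K − D(ρ a, τ c)}]` is nonzero of `ε`-degree EXACTLY `hK − ω`. -/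
theorem inner_det_natDegree (ρ τ : Fin h → Fin (h + h)) (hρ : Function.Injective ρ)
    (hτ : Function.Injective τ) (D : Fin (h + h) → Fin (h + h) → ℕ) (K : ℕ) (hK : ∀ x y, D x y ≤ K)
    (ω : ℕ) (hω : ω = univ.inf' univ_nonempty (fun σ : Equiv.Perm (Fin h) => ∑ a, D (ρ a) (τ (σ a)))) :
    (Matrix.of fun a c : Fin h =>
        (C (MvPolynomial.X (ρ a, τ c)) * X ^ (K - D (ρ a) (τ c)) : (MvPolynomial (Fin (h + h) × Fin (h + h)) ℂ)[X])).det ≠ 0 ∧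
      (Matrix.of fun a c : Fin h =>
        (C (MvPolynomial.X (ρ a, τ c)) * X ^ (K - D (ρ a) (τ c)) : (MvPolynomial (Fin (h + h) × Fin (h + h)) ℂ)[X])).det.natDegree =
        h * K - ω := by
  set wt : Equiv.Perm (Fin h) → ℕ := fun σ => ∑ a, D (ρ a) (τ (σ a)) with hwt
  have hωle : ∀ σ, ω ≤ wt σ := fun σ => by rw [hω]; exact Finset.inf'_le _ (mem_univ σ)
  have hwtK : ∀ σ, wt σ ≤ h * K := fun σ => by
    calc wt σ = ∑ a, D (ρ a) (τ (σ a)) := rfl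
      _ ≤ ∑ _a : Fin h, K := Finset.sum_le_sum fun a _ => hK _ _
      _ = h * K := by simp
  set P := (Matrix.of fun a c : Fin h =>
    (C (MvPolynomial.X (ρ a, τ c)) * X ^ (K - D (ρ a) (τ c)) : (MvPolynomial (Fin (h + h) × Fin (h + h)) ℂ)[X])).det with hPdef
  have hP : P = ∑ σ : Equiv.Perm (Fin h), (((Equiv.Perm.sign σ : ℤˣ) : ℤ) : (MvPolynomial (Fin (h + h) × Fin (h + h)) ℂ)[X]) *
      (C (∏ a, MvPolynomial.X (ρ a, τ (σ a))) * X ^ (h * K - wt σ)) := by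
    rw [hPdef, inner_det_eq]
    refine Finset.sum_congr rfl fun σ _ => ?_
    rw [sum_tsub_eq ρ τ D K hK σ]
  -- coefficient of the term of `σ` at degree `k`
  have hcoeff_term : ∀ (σ : Equiv.Perm (Fin h)) (k : ℕ),
      ((((Equiv.Perm.sign σ : ℤˣ) : ℤ) : (MvPolynomial (Fin (h + h) × Fin (h + h)) ℂ)[X]) *
        (C (∏ a, MvPolynomial.X (ρ a, τ (σ a))) * X ^ (h * K - wt σ))).coeff k =
      if k = h * K - wt σ then (((Equiv.Perm.sign σ : ℤˣ) : ℤ) : MvPolynomial (Fin (h + h) × Fin (h + h)) ℂ) *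
        ∏ a, MvPolynomial.X (ρ a, τ (σ a)) else 0 := by
    intro σ k
    rw [← C_eq_intCast, ← mul_assoc, ← C_mul, coeff_C_mul, coeff_X_pow]
    split_ifs <;> simp
  -- degree bound
  have hdeg_le : P.natDegree ≤ h * K - ω := by
    rw [hP]
    refine natDegree_sum_le_of_forall_le _ _ fun σ _ => ?_
    refine (natDegree_le_iff_coeff_eq_zero).mpr fun k hk => ?_
    rw [hcoeff_term, if_neg]
    have := hωle σ
    omega
  -- the top coefficient
  have htop : P.coeff (h * K - ω) =
      ∑ σ ∈ univ.filter (fun σ => wt σ = ω),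
        (((Equiv.Perm.sign σ : ℤˣ) : ℤ) : MvPolynomial (Fin (h + h) × Fin (h + h)) ℂ) * ∏ a, MvPolynomial.X (ρ a, τ (σ a)) := by
    rw [hP, finsetSum_coeff, Finset.sum_filter]
    refine Finset.sum_congr rfl fun σ _ => ?_
    rw [hcoeff_term]
    have h1 := hωle σ; have h2 := hwtK σ
    by_cases hσ : wt σ = ω
    · rw [if_pos (by rw [hσ]), if_pos hσ]
    · rw [if_neg (by omega), if_neg hσ]
  have hS : (univ.filter (fun σ => wt σ = ω)).Nonempty := by
    obtain ⟨σ, -, hσ⟩ := Finset.exists_mem_eq_inf' (s := (univ : Finset (Equiv.Perm (Fin h))))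
      univ_nonempty (fun σ : Equiv.Perm (Fin h) => ∑ a, D (ρ a) (τ (σ a)))
    exact ⟨σ, by simp [hwt, hω, hσ]⟩
  have htop_ne : P.coeff (h * K - ω) ≠ 0 := by
    rw [htop]; exact signedSum_prod_X_ne_zero ρ τ hρ hτ _ hS
  have hdeg : P.natDegree = h * K - ω :=
    le_antisymm hdeg_le (le_natDegree_of_ne_zero htop_ne)
  refine ⟨fun hP0 => htop_ne (by rw [hP0, coeff_zero]), hdeg⟩

end Inner

/-! ## 3. The transversal maps are injective -/

section Transversal

variable {h : ℕ}

open Summit.ValiantsHypothesis.ValiantsHypothesis.Theorems.BarrierLever.ProductStateSums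
  (castAdd_ne_natAdd)

/-- The row transversal `a ↦ castAdd a / natAdd a` of a set `U` is injective. -/
theorem rowTransversal_injective (U : Finset (Fin h)) :
    Function.Injective (fun a : Fin h => if a ∈ U then Fin.castAdd h a else Fin.natAdd h a) := by
  intro a b hab
  simp only at hab
  by_cases ha : a ∈ U <;> by_cases hb : b ∈ U <;> simp only [ha, hb, if_true, if_false] at hab
  · exact Fin.castAdd_injective _ _ hab
  · exact absurd hab (castAdd_ne_natAdd a b)
  · exact absurd hab.symm (castAdd_ne_natAdd b a)
  · exact Fin.natAdd_injective _ _ hab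

/-- The column transversal `c ↦ natAdd c / castAdd c` of a set `W` is injective. -/
theorem colTransversal_injective (W : Finset (Fin h)) :
    Function.Injective (fun c : Fin h => if c ∈ W then Fin.natAdd h c else Fin.castAdd h c) := by
  intro a b hab
  simp only at hab
  by_cases ha : a ∈ W <;> by_cases hb : b ∈ W <;> simp only [ha, hb, if_true, if_false] at hab
  · exact Fin.natAdd_injective _ _ hab
  · exact absurd hab.symm (castAdd_ne_natAdd b a)
  · exact absurd hab (castAdd_ne_natAdd a b)
  · exact Fin.castAdd_injective _ _ hab

end Transversal

/-! ## 4. Specialisation: a nonzero element of `R[ε]` is nonzero at a complex point -/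

section Specialise

variable {h : ℕ}

/-- A nonzero `P ∈ (ℂ[c])[ε]` takes a nonzero value at some `(c, ε) ∈ ℂ^{(2h)²} × ℂ`. -/
theorem exists_eval_map_ne_zero (P : (MvPolynomial (Fin (h + h) × Fin (h + h)) ℂ)[X]) (hP : P ≠ 0) :
    ∃ (v : Fin (h + h) × Fin (h + h) → ℂ) (e : ℂ), (P.map (MvPolynomial.eval v)).eval e ≠ 0 := by
  have hlc : P.leadingCoeff ≠ 0 := leadingCoeff_ne_zero.mpr hP
  obtain ⟨v, hv⟩ : ∃ v : Fin (h + h) × Fin (h + h) → ℂ, MvPolynomial.eval v P.leadingCoeff ≠ 0 := by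
    by_contra hcon
    push Not at hcon
    exact hlc (MvPolynomial.funext fun v => by rw [hcon v, map_zero])
  have hmap : P.map (MvPolynomial.eval v) ≠ 0 := by
    intro h0
    have := congrArg (fun Q => Q.coeff P.natDegree) h0
    simp only [coeff_map, coeff_zero] at this
    exact hv this
  obtain ⟨e, he⟩ := ResultantKernel.exists_eval_ne_zero_of_ne_zero hmap
  exact ⟨v, e, he⟩

end Specialise

/-! ## 5. The item -/

section Headline

/-- **Item `TropicalDetCertificateSuffices` (stmt-ValiantsHypothesis-19315), signature verbatim.**
A unique minimiser `π₀` of the OUTER assignment problem over the tropical determinants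
`ω i j = min_σ Σ_a D (ρ_{u_i} a) (τ_{w_j} (σ a))` gives a complex matrix `H` whose transversal layout
matrix `(det H[ρ_{u_i}, τ_{w_j}])_{i,j}` is nonsingular (`H_{xy} = c_{xy} ε^{K − D_{xy}}` for suitable
complex `c`, `ε`). -/
theorem tropicalDetCertificateSuffices :
    ∀ (h r : ℕ) (u w : Fin r → Finset (Fin h)) (D : Fin (h + h) → Fin (h + h) → ℕ)
      (ω : Fin r → Fin r → ℕ), (∀ i j, ω i j = Finset.univ.inf' Finset.univ_nonempty
        (fun σ : Equiv.Perm (Fin h) => ∑ a : Fin h, D (if a ∈ u i then Fin.castAdd h a else Fin.natAdd h a)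
          (if σ a ∈ w j then Fin.natAdd h (σ a) else Fin.castAdd h (σ a)))) →
      ∀ π₀ : Equiv.Perm (Fin r), (∀ σ : Equiv.Perm (Fin r), σ ≠ π₀ → ∑ j, ω (π₀ j) j < ∑ j, ω (σ j) j) →
      ∃ H : Matrix (Fin (h + h)) (Fin (h + h)) ℂ, (Matrix.of fun i j : Fin r =>
        (H.submatrix (fun a : Fin h => if a ∈ u i then Fin.castAdd h a else Fin.natAdd h a)
          (fun c : Fin h => if c ∈ w j then Fin.natAdd h c else Fin.castAdd h c)).det).det ≠ 0 := by
  intro h r u w D ω hω π₀ huniq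
  classical
  -- transversal maps
  set ρ : Fin r → Fin h → Fin (h + h) :=
    fun i a => if a ∈ u i then Fin.castAdd h a else Fin.natAdd h a with hρ
  set τ : Fin r → Fin h → Fin (h + h) :=
    fun j c => if c ∈ w j then Fin.natAdd h c else Fin.castAdd h c with hτ
  have hρinj : ∀ i, Function.Injective (ρ i) := fun i => rowTransversal_injective (u i)
  have hτinj : ∀ j, Function.Injective (τ j) := fun j => colTransversal_injective (w j)
  have hω' : ∀ i j, ω i j = univ.inf' univ_nonempty
      (fun σ : Equiv.Perm (Fin h) => ∑ a, D (ρ i a) (τ j (σ a))) := fun i j => hω i j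
  -- the bound `K`
  set K : ℕ := (univ : Finset (Fin (h + h) × Fin (h + h))).sup (fun p => D p.1 p.2) with hK
  have hDK : ∀ x y, D x y ≤ K := fun x y =>
    Finset.le_sup (f := fun p : Fin (h + h) × Fin (h + h) => D p.1 p.2) (mem_univ (x, y))
  have hωK : ∀ i j, ω i j ≤ h * K := by
    intro i j
    rw [hω' i j]
    refine (Finset.inf'_le _ (mem_univ (1 : Equiv.Perm (Fin h)))).trans ?_
    calc ∑ a, D (ρ i a) (τ j ((1 : Equiv.Perm (Fin h)) a)) ≤ ∑ _a : Fin h, K :=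
          Finset.sum_le_sum fun a _ => hDK _ _
      _ = h * K := by simp
  -- the symbolic matrix `H(c, ε)` and its inner determinants
  set Hs : Matrix (Fin (h + h)) (Fin (h + h)) (MvPolynomial (Fin (h + h) × Fin (h + h)) ℂ)[X] :=
    fun x y => C (MvPolynomial.X (x, y)) * X ^ (K - D x y) with hHs
  set M : Matrix (Fin r) (Fin r) (MvPolynomial (Fin (h + h) × Fin (h + h)) ℂ)[X] :=
    Matrix.of fun i j => ((Hs.submatrix (ρ i) (τ j)).det) with hM
  have hinner : ∀ i j, M i j ≠ 0 ∧ (M i j).natDegree = h * K - ω i j := by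
    intro i j
    have key := inner_det_natDegree (ρ i) (τ j) (hρinj i) (hτinj j) D K hDK (ω i j) (hω' i j)
    have hsub : Hs.submatrix (ρ i) (τ j) = Matrix.of fun a c : Fin h =>
        (C (MvPolynomial.X (ρ i a, τ j c)) * X ^ (K - D (ρ i a) (τ j c)) : (MvPolynomial (Fin (h + h) × Fin (h + h)) ℂ)[X]) := by
      ext a c; rfl
    simp only [hM, Matrix.of_apply, hsub]
    exact key
  -- the outer determinant is nonzero in `R[ε]`
  have hdet : M.det ≠ 0 := by
    refine det_ne_zero_of_unique_maxDegree M π₀ (fun j => (hinner _ _).1) fun σ hσ => Or.inr ?_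
    simp only [fun i j => (hinner i j).2]
    have hlt := huniq σ hσ
    -- Σ_j (hK − ω (σ j) j) < Σ_j (hK − ω (π₀ j) j)
    have e1 : ∑ j, (h * K - ω (σ j) j) + ∑ j, ω (σ j) j = r * (h * K) := by
      rw [← Finset.sum_add_distrib, Finset.sum_congr rfl fun j _ => Nat.sub_add_cancel (hωK _ _)]
      simp
    have e2 : ∑ j, (h * K - ω (π₀ j) j) + ∑ j, ω (π₀ j) j = r * (h * K) := by
      rw [← Finset.sum_add_distrib, Finset.sum_congr rfl fun j _ => Nat.sub_add_cancel (hωK _ _)]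
      simp
    omega
  -- specialise `c` and `ε`
  obtain ⟨v, e, hve⟩ := exists_eval_map_ne_zero M.det hdet
  set φ : (MvPolynomial (Fin (h + h) × Fin (h + h)) ℂ)[X] →+* ℂ := (evalRingHom e).comp (mapRingHom (MvPolynomial.eval v)) with hφ
  have hφdet : φ M.det ≠ 0 := by simpa [hφ] using hve
  refine ⟨Matrix.of fun x y => v (x, y) * e ^ (K - D x y), ?_⟩
  have hH : (Matrix.of fun x y => v (x, y) * e ^ (K - D x y)) = Hs.map φ := by
    ext x y
    simp [hHs, hφ]
  rw [RingHom.map_det] at hφdet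
  have hmat : (Matrix.of fun i j : Fin r =>
      ((Matrix.of fun x y => v (x, y) * e ^ (K - D x y)).submatrix
        (fun a : Fin h => if a ∈ u i then Fin.castAdd h a else Fin.natAdd h a)
        (fun c : Fin h => if c ∈ w j then Fin.natAdd h c else Fin.castAdd h c)).det) =
      φ.mapMatrix M := by
    ext i j
    rw [hH, RingHom.mapMatrix_apply, Matrix.map_apply, Matrix.of_apply, hM, Matrix.of_apply,
      RingHom.map_det, RingHom.mapMatrix_apply, ← Matrix.submatrix_map]
  rw [hmat]
  exact hφdet

end Headline

end

end Summit.ValiantsHypothesis.ValiantsHypothesis.Theorems.BarrierLever.TropicalDet
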